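import Summits.Ventures.PercRepro.ProfilePointedCircuitClassesReduction

/-!
# PercRepro — THE BOTTOM-LEVEL PER-CIRCUIT CLASSES AT EVERY NULLITY: THE TWO OUTER CLASSES, THE PARALLEL BRIDGE AND
THE TRIANGLE BRIDGE, GENERIC IN `ν` (p5, gen 37; `proofs/P5-GM1.md` §53(a), (e))

On a matroid with `#E = ρ(E) + ν`, `ρ(E) ≥ ν + 2`, the bottom level is `ν` and its mirror level `n − ν − 1`.  Generic
in `ν`: the class `#C = ν` (`Δ ≤ 1 ≤ U`), the class `#C = ν − 1` (the double counting with the uniform bound `ρ − ν`),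
the class `#C = 1` modulo the weak bottom step of the minor `N ／ x ∖ w` (`P_{ν−1} ≤ P_ν` there — the kernel has it for
nullity `≤ 4`), and the class `#C = 2` modulo the per-point in–out inequality `in_{ν−1}(w₂) ≤ out_ν(w₂)` on the minor
`N ／ x ∖ w₁` — both through the reduction `gammaC_eq_thruCount_contract_delete`.  The classes `3 ≤ #C ≤ ν − 2` are the
per-set refinements `(A_S)` with `2 ≤ #S ≤ ν − 3` one nullity down (`gammaC_le_iff_thruCount_le`); nothing generic is
known for them beyond the injections of §52 / §53 (nullity `≤ 5`).
-/

open scoped Matroid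

namespace PercRepro.Cogirth

open Finset ThmH Skew Shadow Profile

variable {α : Type} [DecidableEq α] {N : Matroid α} [N.Finite]

section Generic

/-- **THE CLASS `#C = ν` AT EVERY NULLITY `ν`** (`Δ ≤ 1 ≤ U`, §52(b) / §53(e) made generic): at most one captured `ν`-set
(`W = C` itself), and if it is there then so is a captured `(n − ν − 1)`-set of the class — a basis `J ⊇ W` of `E − x`
minus a point of `J ∖ W` (p10's `exists_mem_capLevel_superset` and the superset lemma). -/
theorem gammaC_le_of_card_eq_nullity {ν : ℕ} (hn : (gr N).card = rk N (gr N) + ν) (hR : ν + 2 ≤ rk N (gr N))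
    (x : α) {C : Finset α} (hC : C.card = ν) : gammaC N ν x C ≤ gammaC N ((gr N).card - (ν + 1)) x C := by
  unfold gammaC
  -- every captured `4`-set of the class is `C` itself
  have hsub : ∀ W ∈ (biIndepSets N ν).filter (fun W => x ∉ W ∧ x ∈ clF N W ∧ fundC N W x = C), W = C := by
    intro W hW
    have h1 : C ⊆ W := subset_of_mem_gammaC_filter hW
    have h2 : W.card = ν := (mem_biIndepSets.1 (mem_filter.1 hW).1).2.1
    exact (eq_of_subset_of_card_le h1 (by omega)).symm
  rcases ((biIndepSets N ν).filter (fun W => x ∉ W ∧ x ∈ clF N W ∧ fundC N W x = C)).eq_empty_or_nonempty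
    with hemp | ⟨W, hW⟩
  · rw [hemp, card_empty]
    exact Nat.zero_le _
  have hle : ((biIndepSets N ν).filter (fun W => x ∉ W ∧ x ∈ clF N W ∧ fundC N W x = C)).card ≤ 1 :=
    card_le_one.2 (fun a ha b hb => by rw [hsub a ha, hsub b hb])
  have hWC := hsub W hW
  subst hWC
  rw [mem_filter, mem_biIndepSets] at hW
  obtain ⟨⟨hWg, hWcard, hWrk, hWcompl⟩, hxW, hxcl, hfund⟩ := hW
  -- `W` is captured at the level `ν`; take a captured superset at the level `n − ν` and drop a point of it
  have hWcap : W ∈ capLevel N x ν := by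
    rw [mem_capLevel, mem_capSets, mem_biIndepAll]
    exact ⟨⟨⟨⟨hWg, hWrk, hWcompl⟩, hxW⟩, hxcl⟩, hWcard⟩
  obtain ⟨X', hX', hWX'⟩ := exists_mem_capLevel_superset (M := N) (p := x) (k := ν) (by omega) hWcap
  rw [mem_capLevel, mem_capSets, mem_biIndepAll] at hX'
  obtain ⟨⟨⟨⟨hX'g, hX'rk, hX'compl⟩, hxX'⟩, hxclX'⟩, hX'card⟩ := hX'
  have hlt : W.card < X'.card := by omega
  obtain ⟨u, huX', huW⟩ := exists_mem_notMem_of_card_lt_card hlt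
  -- the target `V := X' − u`
  set V := X'.erase u with hV
  have hVX' : V ⊆ X' := erase_subset u X'
  have hWV : W ⊆ V := by
    intro w hw
    rw [hV, mem_erase]
    exact ⟨fun h => huW (h ▸ hw), hWX' hw⟩
  have hVg : V ⊆ gr N := hVX'.trans hX'g
  have hVcard : V.card = (gr N).card - (ν + 1) := by
    rw [hV, card_erase_of_mem huX', hX'card]
    omega
  have hVrk : rk N V = V.card := rk_eq_card_of_subset_of_rk_eq_card hVX' hX'rk
  have hVcompl : rk N (gr N \ V) = (gr N \ V).card :=
    rk_eq_card_of_subset_of_rk_eq_card (sdiff_subset_sdiff (Subset.refl _) hWV) hWcompl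
  have hxV : x ∉ V := fun h => hxX' (hVX' h)
  have hxclV : x ∈ clF N V := mem_clF_of_subset hWV hxcl
  have hfundV : fundC N V x = W :=
    fundC_eq_of_subset hWg hWrk hxcl hfund (hfund ▸ hxcl) hWV hVg hVrk hxclV
  -- hence the level-`(n − 5)` class is non-empty
  have hpos : 0 < ((biIndepSets N ((gr N).card - (ν + 1))).filter
      (fun Y => x ∉ Y ∧ x ∈ clF N Y ∧ fundC N Y x = W)).card :=
    card_pos.2 ⟨V, mem_filter.2 ⟨mem_biIndepSets.2 ⟨hVg, hVcard, hVrk, hVcompl⟩, hxV, hxclV, hfundV⟩⟩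
  omega

/-- **THE CLASS `#C = ν − 1` AT EVERY NULLITY `ν ≥ 1`** (§52(b) / §53(e) made generic, as a double counting of the containment
edges demand ⊆ unit with the uniform bound `ρ − ν`): every demand `W = C + p` has at least `ρ − ν` units above it
(`J − b`, `b ∈ J ∖ W`, for a basis `J ⊇ W` of `E − x`), every unit `V` has at most `ρ − ν` demands below it
(`W ↦ W ∖ C`, a point of `V ∖ C`), so `(ρ − ν)·Δ ≤ #edges ≤ (ρ − ν)·U`. -/
theorem gammaC_le_of_card_eq_nullity_sub_one {ν : ℕ} (hn : (gr N).card = rk N (gr N) + ν) (hR : ν + 2 ≤ rk N (gr N))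
    (x : α) {C : Finset α} (hν : 1 ≤ ν) (hC : C.card = ν - 1) : gammaC N ν x C ≤ gammaC N ((gr N).card - (ν + 1)) x C := by
  unfold gammaC
  set D := (biIndepSets N ν).filter (fun W => x ∉ W ∧ x ∈ clF N W ∧ fundC N W x = C) with hD
  set U := (biIndepSets N ((gr N).card - (ν + 1))).filter (fun V => x ∉ V ∧ x ∈ clF N V ∧ fundC N V x = C) with hU
  -- every demand `W = C + p` has at least `ρ − 4` units above it: `J − b`, `b ∈ J ∖ W`, for a basis `J ⊇ W` of `E − x`
  have hdeg : ∀ W ∈ D, rk N (gr N) - ν ≤ (U.filter (fun V => W ⊆ V)).card := by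
    intro W hW
    rw [hD, mem_filter, mem_biIndepSets] at hW
    obtain ⟨⟨hWg, hWcard, hWrk, hWcompl⟩, hxW, hxcl, hfund⟩ := hW
    have hCW : C ⊆ W := hfund ▸ fundC_subset W x
    obtain ⟨p, hpW, hpC⟩ := exists_mem_notMem_of_card_lt_card (show C.card < W.card by omega)
    have hWe : W.erase p = C := by
      apply (eq_of_subset_of_card_le _ _).symm
      · intro c hc
        rw [mem_erase]
        exact ⟨fun h => hpC (h ▸ hc), hCW hc⟩
      · rw [card_erase_of_mem hpW]
        omega
    have hxC : x ∈ clF N C := by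
      have hpf : p ∉ fundC N W x := by rw [hfund]; exact hpC
      unfold fundC at hpf
      rw [mem_filter, not_and] at hpf
      have h := not_not.1 (hpf hpW)
      rw [hWe] at h
      exact h
    obtain ⟨J, hWJ, hJE, hJrk, hJcard⟩ := exists_indep_erase_superset_card_rk hWg hWrk hxW hxcl
    have hJg : J ⊆ gr N := hJE.trans (erase_subset _ _)
    have hxJ : x ∉ J := fun h => (mem_erase.1 (hJE h)).1 rfl
    have hmaps : ∀ b ∈ J \ W, J.erase b ∈ U.filter (fun V => W ⊆ V) := by
      intro b hb
      rw [mem_sdiff] at hb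
      have hWV : W ⊆ J.erase b := by
        intro w hw
        rw [mem_erase]
        exact ⟨fun h => hb.2 (h ▸ hw), hWJ hw⟩
      have hVg : J.erase b ⊆ gr N := (erase_subset _ _).trans hJg
      have hVrk : rk N (J.erase b) = (J.erase b).card := rk_eq_card_of_subset_of_rk_eq_card (erase_subset _ _) hJrk
      have hxV : x ∉ J.erase b := fun h => hxJ (erase_subset _ _ h)
      have hxclV : x ∈ clF N (J.erase b) := mem_clF_of_subset hWV hxcl
      rw [mem_filter, hU, mem_filter, mem_biIndepSets]
      refine ⟨⟨⟨hVg, ?_, hVrk, ?_⟩, hxV, hxclV, ?_⟩, hWV⟩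
      · rw [card_erase_of_mem hb.1, hJcard]
        omega
      · exact rk_eq_card_of_subset_of_rk_eq_card (sdiff_subset_sdiff (Subset.refl _) hWV) hWcompl
      · exact fundC_eq_of_subset hWg hWrk hxcl hfund hxC hWV hVg hVrk hxclV
    have hinj : Set.InjOn (fun b => J.erase b) (J \ W : Finset α) := by
      intro b hb b' hb' hbb'
      rw [mem_coe, mem_sdiff] at hb hb'
      by_contra hne
      have : b ∈ J.erase b' := mem_erase.2 ⟨hne, hb.1⟩
      simp only at hbb'
      rw [← hbb'] at this
      exact (mem_erase.1 this).1 rfl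
    calc rk N (gr N) - ν = (J \ W).card := by
          rw [card_sdiff_of_subset hWJ, hJcard, hWcard]
      _ ≤ (U.filter (fun V => W ⊆ V)).card := card_le_card_of_injOn _ hmaps hinj
  -- every unit `V` has at most `ρ − 4` demands below it: `W ↦ W ∖ C`, a point of `V ∖ C`
  have hco : ∀ V ∈ U, (D.filter (fun W => W ⊆ V)).card ≤ rk N (gr N) - ν := by
    intro V hV
    rw [hU, mem_filter, mem_biIndepSets] at hV
    obtain ⟨⟨hVg, hVcard, hVrk, hVcompl⟩, hxV, hxclV, hfundV⟩ := hV
    have hCV : C ⊆ V := hfundV ▸ fundC_subset V x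
    have hmaps : ∀ W ∈ D.filter (fun W => W ⊆ V), W \ C ∈ powersetCard 1 (V \ C) := by
      intro W hW
      rw [mem_filter] at hW
      obtain ⟨hWD, hWV⟩ := hW
      rw [hD, mem_filter, mem_biIndepSets] at hWD
      obtain ⟨⟨_, hWcard, _, _⟩, _, _, hfund⟩ := hWD
      have hCW : C ⊆ W := hfund ▸ fundC_subset W x
      rw [mem_powersetCard]
      refine ⟨sdiff_subset_sdiff hWV (Subset.refl _), ?_⟩
      rw [card_sdiff_of_subset hCW, hWcard, hC]
      omega
    have hinj : Set.InjOn (fun W => W \ C) (D.filter (fun W => W ⊆ V) : Finset (Finset α)) := by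
      intro W hW W' hW' h
      rw [mem_coe, mem_filter, hD, mem_filter] at hW hW'
      have hCW : C ⊆ W := hW.1.2.2.2 ▸ fundC_subset W x
      have hCW' : C ⊆ W' := hW'.1.2.2.2 ▸ fundC_subset W' x
      rw [← sdiff_union_of_subset hCW, ← sdiff_union_of_subset hCW']
      simp only at h
      rw [h]
    calc (D.filter (fun W => W ⊆ V)).card ≤ (powersetCard 1 (V \ C)).card := card_le_card_of_injOn _ hmaps hinj
      _ = rk N (gr N) - ν := by
          rw [card_powersetCard, Nat.choose_one_right, card_sdiff_of_subset hCV, hVcard, hC]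
          omega
  -- the double counting of the containment edges
  have h := sum_card_bipartiteAbove_eq_sum_card_bipartiteBelow (r := fun (W V : Finset α) => W ⊆ V) (s := D) (t := U)
  simp only [bipartiteAbove, bipartiteBelow] at h
  have h1 : D.card * (rk N (gr N) - ν) ≤ ∑ W ∈ D, (U.filter (fun V => W ⊆ V)).card := by
    rw [← smul_eq_mul]
    exact card_nsmul_le_sum _ _ _ hdeg
  have h2 : ∑ V ∈ U, (D.filter (fun W => W ⊆ V)).card ≤ U.card * (rk N (gr N) - ν) := by
    rw [← smul_eq_mul]
    exact sum_le_card_nsmul _ _ _ hco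
  have h3 : D.card * (rk N (gr N) - ν) ≤ U.card * (rk N (gr N) - ν) := by omega
  exact Nat.le_of_mul_le_mul_right h3 (by omega)


/-- **THE PARALLEL BRIDGE, GENERIC**: for `x ∥ w` (`{w} + x` a circuit) and `1 ≤ k`, `k + 2 ≤ n`, the class `{w}` satisfies
`γ(k) ≤ γ(n − 1 − k)` as soon as `P_{k−1} ≤ P_k` on the minor `N ／ x ∖ w` (its levels `k − 1` and `n − 2 − k` are
mirror levels, `card_biIndepSets_symm`). -/
theorem gammaC_le_of_card_eq_one_of_step {x w : α} (hw : w ∈ gr N) (hx : x ∈ gr N) (hxw : x ≠ w)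
    (hw1 : rk N {w} = 1) (hxcl : x ∈ clF N {w}) (hxe : x ∉ clF N ∅) {k : ℕ} (hk : 1 ≤ k)
    (hkn : k + 2 ≤ (gr N).card)
    (hstep : (biIndepSets ((N ／ ({x} : Set α)) ＼ ({w} : Set α)) (k - 1)).card ≤
      (biIndepSets ((N ／ ({x} : Set α)) ＼ ({w} : Set α)) k).card) :
    gammaC N k x {w} ≤ gammaC N ((gr N).card - 1 - k) x {w} := by
  have hC : ({w} : Finset α) ⊆ gr N := singleton_subset_iff.2 hw
  have hxC : x ∉ ({w} : Finset α) := by rw [mem_singleton]; exact hxw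
  have hrk : rk N {w} = ({w} : Finset α).card := by rw [hw1, card_singleton]
  have hfund : ∀ c ∈ ({w} : Finset α), x ∉ clF N (({w} : Finset α).erase c) := by
    intro c hc
    rw [mem_singleton] at hc
    rw [hc, erase_singleton]
    exact hxe
  rw [(gammaC_le_iff_thruCount_le hC hx hxC hrk hxcl hfund (mem_singleton_self w) hk hkn)]
  rw [erase_singleton, thruCount_empty, thruCount_empty]
  have hgr₀ : gr ((N ／ ({x} : Set α)) ＼ ({w} : Set α)) = ((gr N).erase x).erase w := by
    rw [gr_delete', gr_contract']
  have hcard₀ : (gr ((N ／ ({x} : Set α)) ＼ ({w} : Set α))).card = (gr N).card - 2 := by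
    rw [hgr₀, card_erase_of_mem (mem_erase.2 ⟨fun h => hxw h.symm, hw⟩), card_erase_of_mem hx]
    omega
  have hsym := card_biIndepSets_symm ((N ／ ({x} : Set α)) ＼ ({w} : Set α)) (k := k) (by rw [hcard₀]; omega)
  rw [hcard₀] at hsym
  have e : (gr N).card - 2 - k = (gr N).card - 2 - k := rfl
  rw [← hsym]
  exact hstep

/-- **THE TRIANGLE BRIDGE, GENERIC**: for a triangle `{x, w₁, w₂}` and `1 ≤ k`, `k + 2 ≤ n`, the class `{w₁, w₂}` satisfies
`γ(k) ≤ γ(n − 1 − k)` as soon as `in_{k−1}(w₂) ≤ out_k(w₂)` on the minor `N ／ x ∖ w₁` (`inCount_sub_eq_outCount`). -/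
theorem gammaC_le_of_card_eq_two_of_inout' {x w₁ w₂ : α} (hw12 : w₁ ≠ w₂) (hC : ({w₁, w₂} : Finset α) ⊆ gr N)
    (hx : x ∈ gr N) (hxC : x ∉ ({w₁, w₂} : Finset α)) (hrk : rk N {w₁, w₂} = 2) (hxcl : x ∈ clF N {w₁, w₂})
    (hxn2 : x ∉ clF N {w₂}) (hxn1 : x ∉ clF N {w₁}) {k : ℕ} (hk : 1 ≤ k) (hkn : k + 2 ≤ (gr N).card)
    (hio : inCount ((N ／ ({x} : Set α)) ＼ ({w₁} : Set α)) (k - 1) w₂ ≤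
      outCount ((N ／ ({x} : Set α)) ＼ ({w₁} : Set α)) k w₂) :
    gammaC N k x {w₁, w₂} ≤ gammaC N ((gr N).card - 1 - k) x {w₁, w₂} := by
  have hrk' : rk N {w₁, w₂} = ({w₁, w₂} : Finset α).card := by rw [hrk, card_pair hw12]
  have hfund : ∀ c ∈ ({w₁, w₂} : Finset α), x ∉ clF N (({w₁, w₂} : Finset α).erase c) := by
    intro c hc
    rw [mem_insert, mem_singleton] at hc
    rcases hc with rfl | rfl
    · have e : ({c, w₂} : Finset α).erase c = {w₂} := by
        rw [erase_insert]
        rw [mem_singleton]; exact hw12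
      rw [e]; exact hxn2
    · have e : ({w₁, c} : Finset α).erase c = {w₁} := by
        rw [erase_insert_of_ne hw12, erase_singleton, insert_empty]
      rw [e]; exact hxn1
  rw [gammaC_le_iff_thruCount_le hC hx hxC hrk' hxcl hfund (mem_insert_self w₁ {w₂}) hk hkn]
  have e1 : ({w₁, w₂} : Finset α).erase w₁ = {w₂} := by
    rw [erase_insert]
    rw [mem_singleton]; exact hw12
  rw [e1, thruCount_singleton, thruCount_singleton]
  have hw₁g : w₁ ∈ gr N := hC (mem_insert_self _ _)
  have hw₂g : w₂ ∈ gr N := hC (mem_insert_of_mem (mem_singleton_self _))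
  have hxw₁ : x ≠ w₁ := fun h => hxC (h ▸ mem_insert_self _ _)
  have hxw₂ : x ≠ w₂ := fun h => hxC (h ▸ mem_insert_of_mem (mem_singleton_self _))
  have hgr₀ : gr ((N ／ ({x} : Set α)) ＼ ({w₁} : Set α)) = ((gr N).erase x).erase w₁ := by
    rw [gr_delete', gr_contract']
  have hcard₀ : (gr ((N ／ ({x} : Set α)) ＼ ({w₁} : Set α))).card = (gr N).card - 2 := by
    rw [hgr₀, card_erase_of_mem (mem_erase.2 ⟨fun h => hxw₁ h.symm, hw₁g⟩), card_erase_of_mem hx]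
    omega
  have hw₂g₀ : w₂ ∈ gr ((N ／ ({x} : Set α)) ＼ ({w₁} : Set α)) := by
    rw [hgr₀]
    exact mem_erase.2 ⟨hw12.symm, mem_erase.2 ⟨fun h => hxw₂ h.symm, hw₂g⟩⟩
  have hsym := inCount_sub_eq_outCount (M := (N ／ ({x} : Set α)) ＼ ({w₁} : Set α)) (k := k) hw₂g₀
    (by rw [hcard₀]; omega)
  rw [hcard₀] at hsym
  rw [hsym]
  exact hio

end Generic

end PercRepro.Cogirth
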